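import Summits.QuantumFields.YangMills.Theorems.FluctuationComparisonRegPrIntLLargeFieldGasKnitAE
import Summits.QuantumFields.YangMills.Theorems.FluctuationComparisonRegPrIntLLargeFieldGasWindowCut
import Summits.QuantumFields.YangMills.Theorems.FluctuationComparisonRegPrIntLLargeFieldGasFootprint
import Summits.QuantumFields.YangMills.Theorems.FluctuationComparisonRegPrIntLLargeFieldGasLabelCount
import Literature.MathematicalPhysics.QuantumFieldTheory.Balaban1983to89.T3InteriorExcision
import HarnessLib

/-!
# LFG^{can}∘ SOCKET (G8): ★★★ `canIntBody_of_engine` — the ∃-body of LFG^{can}∘ at one `(J, K)` from the 𝐑-OPERATION'S OUTPUT ROWS ALONE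
# (✓p789065 `…KnitAE.canIntBody_of_factorised_histories` with the footprint geometry (FILE 7), the deep-label locator ∕ count ∕ budget (FILE 8), the window cut (H+W)
# (✓px10 g16 `…WindowCut`) and the off-deep vanishing (✓`…KnitAE.ratio_eq_zero_of_not_deep`) PLUGGED — the hypotheses left are Bałaban's expansion with holes, by name)

Cell `ym3-torus` (HUMAN RULING D-0037: rung R3 = continuum `SU(2)` Yang–Mills on `T³` — NOT `d = 4`, NOT infinite volume, NOT a mass gap, NOT the Clay problem); width seat
`ym3-torus-px10` (gen 17), FILE 9 of the px10 LFG lineage; helper of the crux `stmt-QuantumFields-20520` `UnitScaleTilt.FluctuationComparisonRegPrIntL` (`--supports … --as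
helper`, NOT a proof of it); ★★OWNER WORD №209 (D): «ENGINE rows = the R600 successor of ymfull-r3-prover-1; NON-ENGINE socket letters (G6)(G7)(G8) = px10 g17».  THEOREMS ONLY:
0 `def`, 0 `instance`, 0 `notation`, 0 `sorry`, default heartbeats.

THE STATEMENT.  For a `T3Family` `F`, `0 < γ ≤ 1`, `0 < b₀`, a window shrink `c ≤ 1`, heights `J ≤ K`, a KP rate `κ ≥ 0`, a located budget `Ψ J ≥ 0` (FILE 8 ★★`exists_located_budget`
supplies it for every run at once, with `J·Ψ J → 0`) and the row (r1∘) `hR`, ★★★`canIntBody_of_engine` concludes the VERBATIM ∃-body of LFG^{can}∘ at `(J, K)` — the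
conclusion of ✓`canIntBody_of_factorised_histories`, hence the per-`(J,K)` body of the hypothesis of px10 g16's ✓`…LargeFieldGasInteriorDoor.largeFieldFourPtIntCan_of_canInt`
— from THE ENGINE ROWS, which are, per deep history and in the T³ tower's own letters:
* `Adm` with `hAdm` — the FOOTPRINT MAP of the expansion: an admissible pair `(Q′, X)` has `Q′ ≠ ∅`, every label of `Q′` DEEP (level `< K − J`) and LOCATED in `X`
  (`π l ∈ X`, locator of FILE 8), and `X = ⋃_{y ∈ Fc} cell y` for a touching-connected family `Fc` of BIG BLOCKS `B^μ(y)` of the height-`J` lattice (Bałaban's `M`-cubes,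
  `M = L^μ`, the grain `μ ≤ m + J` a free parameter of the engine; [Balaban1985UV3] (39) p.266: unions of big blocks with `R`-collars; [Balaban1989LargeFieldII] (1.84) p.386);
* `ζ`, `ζbar`, `κmu` with `hrat` — THE A.E. RATIO IDENTITY of the expansion with holes: for every deep history `Q`, `dU_J`-a.e. on the window `W_J^{c} = {PlaqSmall (θBal (c·b₀) J)}`,
  `heightDensity (E_Q) = heightDensity (E_∅) · Σ_{𝒳 compatible, Q ∈ Dec 𝒳} Π_{X ∈ 𝒳} ζ(Q↾X, X, ·)` ([Balaban1985UV3] Thm 2 (43)–(47) pp.266–267 at the step `K − J`;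
  [Balaban1989LargeFieldII] (1.29)–(1.75), (1.90)–(1.91)); `hζc`, `hloc` — the activities are CONTINUOUS on the window and V-LOCAL in their footprint; `hdom`, `hζ0`, `hζ` — THE ENERGY
  BOUND `|ζ(Q′, X, U)| ≤ ζ̄(Q′, X) ≤ (Π_{l ∈ Q′} e^{−a·p(g_{K−j_l})²}) · e^{−κμ·#blocks(X)}` ([Balaban1985UV3] (67)–(71) pp.273–274; [Balaban1989LargeFieldII] (1.97), (1.100));
* ONE NUMERIC RATE ROW `hμ : Ψ J·3L^{3μ} + κ·6L^μ + 2·log 26 + Ψ J + 2 ≤ κμ` (the socket's `Ψ J·s₀ + κ·ℓ₀ + log m + 2 log Δ + Ψ J + 2 ≤ κμ` at `s₀ = 3L^{3μ}`, `ℓ₀ = 6L^μ`,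
  `m = 1`, `Δ = 26`) — satisfiable in print's regime: decay per `M`-cube `κμ ≈ κ_B·L^μ` grows with the grain, `κ` (the KP rate) is ∃-chosen small, and `Ψ J·L^{3μ}` is small
  below a coupling ceiling (✓`…LargeFieldGasBudgetSmall.exists_deep_budget_small`).
Everything else of the socket is DISCHARGED inside: `hΔ h1Δ hm h1m hs₀ hℓ0 hdiam hℓ` (FILE 7), `hσ` (FILE 8's located budget read through FILE 7's `size (Fc.biUnion cell) = |Fc|`),
`hsum` (✓`…WindowCut.heightDensity_univ_ae_eq_sum_deep_on_window` on the shrunken window, ✓`T3InteriorExcision.θBal_mul_le`), `hoff` (✓`ratio_eq_zero_of_not_deep`), `hr := rfl`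
(the ratio `r_Q` IS the factorised sum), `hsf` (✓`smallFactor_pos`).  The depth-one reading (`K = J + 1`, one averaging step; the first bite named by `LOCATE-R1-DEPTH1-r3p1g0.md`)
is the instance `hJK := Nat.le_succ J`: deep labels = the fine plaquettes `Plaq (F.P (J+1)) 0`, one level of holes.

HONEST — WHAT THIS IS NOT.  A composition; the ENGINE ROWS above ARE Bałaban's large-field renormalisation operation for the `d = 3` tower in identity form (XL, OPEN, not in print
in this form for `d = 3`) and are NOT proved here or anywhere in the tree; LFG^{can}∘ ∕ `stub_largeFieldFourPtIntCan` ∕ S2β ∕ the crux 20520 NOT proved; `YM3TorusSU2` NOT proved;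
finite volume ∕ conditional; the Yang–Mills mass gap (Clay) NOT proved; rung R3 = YM₃ on `T³` — NOT `d = 4`, NOT infinite volume, NOT a mass gap.
References: [Balaban1985UV3] T. Bałaban, CMP 102 (1985): (39)–(41) p.266, (43)–(47) pp.266–267, (67)–(71) pp.273–274; [Balaban1989LargeFieldII] CMP 122 (1989): (1.84) p.386,
(1.90)–(1.91) p.388, (1.97)–(1.101) pp.389–390; [Balaban1987RG1] CMP 109 (1987) (0.13) p.254; [KoteckyPreiss1986] CMP 103 (1986), Theorem p.492 (1).
-/

set_option autoImplicit false

noncomputable section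

open Finset MeasureTheory Filter Topology Set
open scoped BigOperators
open Literature.Probability.LatticeModels
open Literature.MathematicalPhysics.QuantumFieldTheory.Balaban1983to89
open Literature.MathematicalPhysics.QuantumFieldTheory.Balaban1983to89.T3ContinuumYM3Torus
open Literature.MathematicalPhysics.QuantumFieldTheory.Balaban1983to89.T3NestedUnitLaws
open Literature.MathematicalPhysics.QuantumFieldTheory.Balaban1983to89.T3UnitLawDensityEML
open Literature.MathematicalPhysics.QuantumFieldTheory.Balaban1983to89.T3UnitScaleTilt
open Literature.MathematicalPhysics.QuantumFieldTheory.Balaban1983to89.T3TiltDescent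
open Literature.MathematicalPhysics.QuantumFieldTheory.Balaban1983to89.T3PrintedRegularMinimiser
open Literature.MathematicalPhysics.QuantumFieldTheory.Balaban1983to89.T3LevelShift
open Literature.MathematicalPhysics.QuantumFieldTheory.Balaban1983to89.Missing
open Literature.MathematicalPhysics.QuantumFieldTheory.Balaban1983to89.T4Continuum
open scoped Literature.MathematicalPhysics.QuantumFieldTheory.Balaban1983to89.T3OrbitAverage
open Literature.MathematicalPhysics.QuantumFieldTheory.Balaban1983to89.Node00 (touchingGraph SiteTouch degree_touchingGraph_siteTouch_le_pred)
open Literature.MathematicalPhysics.QuantumFieldTheory.BalabanImbrieJaffe1984to88.BIJ85BlockAveragesTorusK (blkIter)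
open Summit.QuantumFields.YangMills.Theorems.FluctuationComparisonRegPrIntLWregGlue (heightDensityCan)
open Summit.QuantumFields.YangMills.Theorems.FluctuationComparisonRegPrIntLHistoryPartition (LFLabel histEvent smallFactor smallFactor_pos)
open Summit.QuantumFields.YangMills.Theorems.FluctuationComparisonRegPrIntLLargeFieldGasKnitAE (ratio_eq_zero_of_not_deep canIntBody_of_factorised_histories)
open Summit.QuantumFields.YangMills.Theorems.FluctuationComparisonRegPrIntLLargeFieldGasWindowCut (heightDensity_univ_ae_eq_sum_deep_on_window)
open Literature.MathematicalPhysics.QuantumFieldTheory.Balaban1983to89.B5Eq118OneStroke (iterBlockOf)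
open Summit.QuantumFields.YangMills.Theorems.FluctuationComparisonRegPrIntLLargeFieldGasFootprint (mem_biUnion_cell_iff card_image_blk_biUnion_cell
  supDiam_le_of_adm footprint_hdiam card_filter_mem_cell_le_one card_cell_le one_le_three_pow_sub_one)

namespace Summit.QuantumFields.YangMills.Theorems.FluctuationComparisonRegPrIntLLargeFieldGasSocketOfEngine

/-! ## §1 The socket from the engine rows -/

open Classical in
/-- ★★★ **THE ∃-BODY OF LFG^{can}∘ AT ONE `(J, K)` FROM THE 𝐑-OPERATION'S OUTPUT ROWS ALONE** — ✓`canIntBody_of_factorised_histories` with geometry (FILE 7), locator ∕ count ∕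
budget (FILE 8), (H+W) (✓px10 g16) and off-deep vanishing (✓§1 of KnitAE) plugged.  ENGINE ROWS (hypotheses `Adm hAdm ζ ζbar κmu hrat hζc hloc hdom hζ0 hζ hμ`): the footprint map,
the a.e. ratio identity of the expansion with holes per deep history on the window, continuity ∕ V-locality ∕ energy bound of the activities, one numeric rate row.
[cite: Balaban1985UV3, (43)-(47) pp.266-267 and (67)-(71) pp.273-274; Balaban1989LargeFieldII, (1.84) p.386, (1.90)-(1.91) p.388 and (1.97)-(1.101) pp.389-390; Balaban1987RG1, (0.13) p.254] -/
theorem canIntBody_of_engine (F : T3Family) {γ : ℝ} (hγ : 0 < γ) (hγ1 : γ ≤ 1) {b₀ : ℝ} (hb₀ : 0 < b₀) (p₀ : ℝ) {c : ℝ} (hc1 : c ≤ 1)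
    {J K : ℕ} (hJK : J ≤ K) {κ : ℝ} (hκ : 0 ≤ κ) (Ψ : ℕ → ℝ) (hΨ : 0 ≤ Ψ J) (a : ℝ)
    -- the grain: cells = the `μ`-fold blocks `B^μ(y)` of the height-`J` lattice (Bałaban's `M`-cubes, `M = L^μ`; FILE 7)
    (μ : ℕ) (hμJ : μ ≤ F.m + J)
    -- the located budget per block at `(J, K)` (FILE 8 `exists_located_budget_blocks`, uniform in the run)
    (hbud : ∀ Fc : Finset (Site (F.P J) μ),
      ∑ l ∈ Finset.univ.filter (fun l : LFLabel F K J =>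
          iterBlockOf μ (siteShift (F.sitesPerDir_eq (m := F.m) (K := K) (j := l.1.val + (K - J - l.1.val)) (m' := F.m) (K' := J) (j' := 0)
            (by have := l.1.isLt; omega)) (blkIter (K - J - l.1.val) l.2.src)) ∈ Fc),
        (if l.1.val < K - J then smallFactor F.L γ b₀ p₀ a (K - l.1.val) else 0) ≤ Ψ J * (Fc.card : ℝ))
    -- (r1∘)
    (hR : {U : GaugeField (F.P J) 0 (Matrix.specialUnitaryGroup (Fin 2) ℂ) | PlaqSmall (θBal F.L γ (c * b₀) p₀ J) U} ⊆
      Node00.regSet (fieldMeasure (F.P J) 0 (Matrix.specialUnitaryGroup (Fin 2) ℂ)) (heightDensity F γ hJK Set.univ))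
    -- ═══ THE ENGINE ROWS ═══
    (Adm : Finset (LFLabel F K J) → Finset (PBond (F.P J) 0) → Prop)
    (hAdm : ∀ Q' X, Adm Q' X → Q'.Nonempty ∧
      (∀ l ∈ Q', l.1.val < K - J ∧
        (⟨siteShift (F.sitesPerDir_eq (m := F.m) (K := K) (j := l.1.val + (K - J - l.1.val)) (m' := F.m) (K' := J) (j' := 0)
            (by have := l.1.isLt; omega)) (blkIter (K - J - l.1.val) l.2.src), l.2.μ⟩ : PBond (F.P J) 0) ∈ X) ∧
      ∃ Fc : Finset (Site (F.P J) μ), ((touchingGraph (SiteTouch (P := F.P J) (j := μ))).induce (Fc : Set (Site (F.P J) μ))).Connected ∧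
        Fc.biUnion (fun y => Finset.univ.filter (fun b : PBond (F.P J) 0 => iterBlockOf μ b.src = y)) = X)
    (ζ : Finset (LFLabel F K J) → Finset (PBond (F.P J) 0) → GaugeField (F.P J) 0 (Matrix.specialUnitaryGroup (Fin 2) ℂ) → ℝ)
    (ζbar : Finset (LFLabel F K J) → Finset (PBond (F.P J) 0) → ℝ) (κmu : ℝ)
    (hrat : ∀ Q : Finset (LFLabel F K J), (∀ l ∈ Q, l.1.val < K - J) →
      ∀ᵐ U ∂fieldMeasure (F.P J) 0 (Matrix.specialUnitaryGroup (Fin 2) ℂ), PlaqSmall (θBal F.L γ (c * b₀) p₀ J) U →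
        heightDensity F γ hJK (histEvent F (θBal F.L γ b₀ p₀) K J Q) U =
          heightDensity F γ hJK (histGood F ℰp (θBal F.L γ b₀ p₀) K J) U *
            ∑ 𝒳 ∈ (Finset.univ : Finset (Finset (PBond (F.P J) 0))).powerset.filter (fun 𝒳 => IsCompatible polyInc 𝒳 ∧
                (∀ l ∈ Q, ∃ X ∈ 𝒳, (⟨siteShift (F.sitesPerDir_eq (m := F.m) (K := K) (j := l.1.val + (K - J - l.1.val)) (m' := F.m) (K' := J)
                    (j' := 0) (by have := l.1.isLt; omega)) (blkIter (K - J - l.1.val) l.2.src), l.2.μ⟩ : PBond (F.P J) 0) ∈ X) ∧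
                ∀ X ∈ 𝒳, Adm (Q.filter fun l => (⟨siteShift (F.sitesPerDir_eq (m := F.m) (K := K) (j := l.1.val + (K - J - l.1.val))
                    (m' := F.m) (K' := J) (j' := 0) (by have := l.1.isLt; omega)) (blkIter (K - J - l.1.val) l.2.src), l.2.μ⟩ : PBond (F.P J) 0) ∈ X) X),
              ∏ X ∈ 𝒳, ζ (Q.filter fun l => (⟨siteShift (F.sitesPerDir_eq (m := F.m) (K := K) (j := l.1.val + (K - J - l.1.val))
                  (m' := F.m) (K' := J) (j' := 0) (by have := l.1.isLt; omega)) (blkIter (K - J - l.1.val) l.2.src), l.2.μ⟩ : PBond (F.P J) 0) ∈ X) X U)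
    (hζc : ∀ Q' X, Adm Q' X → ContinuousOn (fun U => ζ Q' X U)
      {U : GaugeField (F.P J) 0 (Matrix.specialUnitaryGroup (Fin 2) ℂ) | PlaqSmall (θBal F.L γ (c * b₀) p₀ J) U})
    (hloc : ∀ Q' X (U U' : GaugeField (F.P J) 0 (Matrix.specialUnitaryGroup (Fin 2) ℂ)), Adm Q' X → (∀ e ∈ X, U e = U' e) → ζ Q' X U = ζ Q' X U')
    (hdom : ∀ Q' X U, Adm Q' X → PlaqSmall (θBal F.L γ (c * b₀) p₀ J) U → |ζ Q' X U| ≤ ζbar Q' X)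
    (hζ0 : ∀ Q' X, Adm Q' X → 0 ≤ ζbar Q' X)
    (hζ : ∀ Q' X, Adm Q' X → ζbar Q' X ≤
      (∏ l ∈ Q', (if l.1.val < K - J then smallFactor F.L γ b₀ p₀ a (K - l.1.val) else 0)) *
        Real.exp (-(κmu * ((X.image (fun b : PBond (F.P J) 0 => iterBlockOf μ b.src)).card : ℝ))))
    -- the ONE numeric rate row: tree decay per block ≥ entropy + pinned size + length (s₀ = 3L^{3μ}, ℓ₀ = 6L^μ, m = 1, Δ = 26)
    (hμ : Ψ J * (3 * ((F.L : ℝ) ^ 3) ^ μ) + κ * (6 * (F.L : ℝ) ^ μ) + 2 * Real.log 26 + Ψ J + 2 ≤ κmu) :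
    ∃ (cst : ℝ) (w : GaugeField (F.P J) 0 (Matrix.specialUnitaryGroup (Fin 2) ℂ) → Finset (PBond (F.P J) 0) → ℝ),
      (∃ (wbar a ℓ' : Finset (PBond (F.P J) 0) → ℝ),
        (∀ U, w U ∅ = 0) ∧
        (∀ (X : Finset (PBond (F.P J) 0)) (U U' : GaugeField (F.P J) 0 (Matrix.specialUnitaryGroup (Fin 2) ℂ)),
          (∀ e ∈ X, U e = U' e) → w U X = w U' X) ∧
        (∀ X, 0 ≤ a X) ∧ (∀ X, 0 ≤ ℓ' X) ∧
        (∀ U, U ∈ {U : GaugeField (F.P J) 0 (Matrix.specialUnitaryGroup (Fin 2) ℂ) | PlaqSmall (θBal F.L γ (c * b₀) p₀ J) U} →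
          ∀ X, |w U X| ≤ wbar X) ∧
        (∀ X : Finset (PBond (F.P J) 0), ∀ e ∈ X, ∀ e' ∈ X, (e.src.tdist e'.src : ℝ) ≤ ℓ' X) ∧
        (∀ X : Finset (PBond (F.P J) 0), ∑ X' ∈ Finset.univ.filter (fun X' => polyInc X' X),
            wbar X' * Real.exp (a X' + κ * ℓ' X') ≤ a X) ∧
        (∀ e : PBond (F.P J) 0, a {e} ≤ Ψ J)) ∧
      ∀ U : GaugeField (F.P J) 0 (Matrix.specialUnitaryGroup (Fin 2) ℂ), PlaqSmall (θBal F.L γ (c * b₀) p₀ J) U →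
        heightDensityCan F γ hJK Set.univ U =
          Real.exp cst * heightDensityCan F γ hJK (histGood F ℰp (θBal F.L γ b₀ p₀) K J) U *
            (polymerPartitionFunction polyInc (fun X : Finset (PBond (F.P J) 0) => ((w U X : ℝ) : ℂ)) Finset.univ).re := by
  have hd : 0 < (F.P J).d := by rw [T3Family.P_d]; norm_num
  have hμ' : μ ≤ (F.P J).m + (F.P J).K := hμJ
  -- FILE 7: the footprint geometry on the `μ`-blocks
  have hΔ : ∀ cc : Site (F.P J) μ, (touchingGraph (SiteTouch (P := F.P J) (j := μ))).degree cc ≤ 3 ^ (F.P J).d - 1 :=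
    fun cc => degree_touchingGraph_siteTouch_le_pred cc
  have h1Δ : 1 ≤ 3 ^ (F.P J).d - 1 := one_le_three_pow_sub_one hd
  have hAdmFc : ∀ Q' X, Adm Q' X → ∃ Fc : Finset (Site (F.P J) μ),
      ((touchingGraph (SiteTouch (P := F.P J) (j := μ))).induce (Fc : Set (Site (F.P J) μ))).Connected ∧
        Fc.biUnion (fun y => Finset.univ.filter (fun b : PBond (F.P J) 0 => iterBlockOf μ b.src = y)) = X :=
    fun Q' X h => (hAdm Q' X h).2.2
  have hℓ : ∀ X : Finset (PBond (F.P J) 0), (∃ Q', Adm Q' X) →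
      ((X.sup fun e => X.sup fun e' => e.src.tdist e'.src : ℕ) : ℝ) ≤
        (2 * ((F.P J).d : ℝ) * ((F.P J).L : ℝ) ^ μ) * (((X.image (fun b : PBond (F.P J) 0 => iterBlockOf μ b.src)).card : ℕ) : ℝ) :=
    fun X hX => supDiam_le_of_adm hd hμ' Adm hAdmFc X hX
  -- FILE 8: the budget row through FILE 7's size
  have hσ : ∀ X : Finset (PBond (F.P J) 0), (∃ Q', Adm Q' X) →
      ∑ l ∈ Finset.univ.filter (fun l : LFLabel F K J =>
          (⟨siteShift (F.sitesPerDir_eq (m := F.m) (K := K) (j := l.1.val + (K - J - l.1.val)) (m' := F.m) (K' := J) (j' := 0)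
            (by have := l.1.isLt; omega)) (blkIter (K - J - l.1.val) l.2.src), l.2.μ⟩ : PBond (F.P J) 0) ∈ X),
        (if l.1.val < K - J then smallFactor F.L γ b₀ p₀ a (K - l.1.val) else 0) ≤
        Ψ J * (((X.image (fun b : PBond (F.P J) 0 => iterBlockOf μ b.src)).card : ℕ) : ℝ) := by
    intro X hX
    obtain ⟨Q', hQ'⟩ := hX
    obtain ⟨Fc, -, rfl⟩ := hAdmFc Q' X hQ'
    rw [card_image_blk_biUnion_cell hd hμ']
    have hset : (Finset.univ.filter fun l : LFLabel F K J =>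
        (⟨siteShift (F.sitesPerDir_eq (m := F.m) (K := K) (j := l.1.val + (K - J - l.1.val)) (m' := F.m) (K' := J) (j' := 0)
            (by have := l.1.isLt; omega)) (blkIter (K - J - l.1.val) l.2.src), l.2.μ⟩ : PBond (F.P J) 0) ∈
          Fc.biUnion (fun y => Finset.univ.filter (fun b : PBond (F.P J) 0 => iterBlockOf μ b.src = y))) =
        Finset.univ.filter (fun l : LFLabel F K J =>
          iterBlockOf μ (siteShift (F.sitesPerDir_eq (m := F.m) (K := K) (j := l.1.val + (K - J - l.1.val)) (m' := F.m) (K' := J) (j' := 0)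
            (by have := l.1.isLt; omega)) (blkIter (K - J - l.1.val) l.2.src)) ∈ Fc) := by
      refine Finset.filter_congr fun l _ => ?_
      rw [mem_biUnion_cell_iff]
      exact Iff.rfl
    rw [hset]
    exact hbud Fc
  -- (H+W) on the shrunken window
  have hθ : θBal F.L γ (c * b₀) p₀ J ≤ θBal F.L γ b₀ p₀ J := T3InteriorExcision.θBal_mul_le (le_of_lt F.hL.2) hγ hγ1 hb₀ hc1 p₀ J
  have hsum : ∀ᵐ U ∂fieldMeasure (F.P J) 0 (Matrix.specialUnitaryGroup (Fin 2) ℂ), PlaqSmall (θBal F.L γ (c * b₀) p₀ J) U →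
      heightDensity F γ hJK Set.univ U = ∑ Q ∈ Finset.univ.filter (fun Q : Finset (LFLabel F K J) => ∀ e ∈ Q, e.1.val < K - J),
        heightDensity F γ hJK (histEvent F (θBal F.L γ b₀ p₀) K J Q) U := by
    filter_upwards [heightDensity_univ_ae_eq_sum_deep_on_window (F := F) (γ := γ) hγ.le hJK (θBal F.L γ b₀ p₀)] with U hU hUc
    exact hU (fun p => (hUc p).trans_le hθ)
  -- off the deep histories the factorised sum is empty
  have hdeep : ∀ Q' X, Adm Q' X → ∀ l ∈ Q',
      (⟨siteShift (F.sitesPerDir_eq (m := F.m) (K := K) (j := l.1.val + (K - J - l.1.val)) (m' := F.m) (K' := J) (j' := 0)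
          (by have := l.1.isLt; omega)) (blkIter (K - J - l.1.val) l.2.src), l.2.μ⟩ : PBond (F.P J) 0) ∈ X ∧ l.1.val < K - J :=
    fun Q' X h l hl => ⟨((hAdm Q' X h).2.1 l hl).2, ((hAdm Q' X h).2.1 l hl).1⟩
  -- small factors are nonnegative
  have hsf : ∀ l : LFLabel F K J, 0 ≤ (if l.1.val < K - J then smallFactor F.L γ b₀ p₀ a (K - l.1.val) else 0) := by
    intro l
    split_ifs
    · exact (smallFactor_pos _ _ _ _ _ _).le
    · exact le_rfl
  -- the rate row in the socket's letters
  have hrate : Ψ J * (((F.P J).d * ((F.P J).L ^ (F.P J).d) ^ μ : ℕ) : ℝ) + κ * (2 * ((F.P J).d : ℝ) * ((F.P J).L : ℝ) ^ μ) +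
      (Real.log ((1 : ℕ) : ℝ) + 2 * Real.log ((3 ^ (F.P J).d - 1 : ℕ) : ℝ)) + Ψ J + 2 ≤ κmu := by
    have h26 : ((3 ^ (F.P J).d - 1 : ℕ) : ℝ) = 26 := by rw [T3Family.P_d]; norm_num
    have hs₀ : (((F.P J).d * ((F.P J).L ^ (F.P J).d) ^ μ : ℕ) : ℝ) = 3 * ((F.L : ℝ) ^ 3) ^ μ := by
      rw [T3Family.P_d, show (F.P J).L = F.L from rfl]; push_cast; ring
    have hℓ₀ : 2 * ((F.P J).d : ℝ) * ((F.P J).L : ℝ) ^ μ = 6 * (F.L : ℝ) ^ μ := by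
      rw [T3Family.P_d, show (F.P J).L = F.L from rfl]; push_cast; ring
    rw [h26, hs₀, hℓ₀, Nat.cast_one, Real.log_one, zero_add]
    linarith
  exact canIntBody_of_factorised_histories F b₀ p₀ c hJK hκ Ψ hR (touchingGraph (SiteTouch (P := F.P J) (j := μ))) hΔ h1Δ
    (fun y => Finset.univ.filter (fun b : PBond (F.P J) 0 => iterBlockOf μ b.src = y)) card_filter_mem_cell_le_one le_rfl (card_cell_le hμ')
    (fun X => (X.image (fun b : PBond (F.P J) 0 => iterBlockOf μ b.src)).card)
    (fun X => ((X.sup fun e => X.sup fun e' => e.src.tdist e'.src : ℕ) : ℝ)) (2 * ((F.P J).d : ℝ) * ((F.P J).L : ℝ) ^ μ)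
    (fun X => Nat.cast_nonneg _) (fun X e he e' he' => footprint_hdiam X e he e' he')
    (fun l : LFLabel F K J => (⟨siteShift (F.sitesPerDir_eq (m := F.m) (K := K) (j := l.1.val + (K - J - l.1.val)) (m' := F.m) (K' := J) (j' := 0)
      (by have := l.1.isLt; omega)) (blkIter (K - J - l.1.val) l.2.src), l.2.μ⟩ : PBond (F.P J) 0))
    Adm ζ ζbar (fun l => if l.1.val < K - J then smallFactor F.L γ b₀ p₀ a (K - l.1.val) else 0) κmu
    (Finset.univ.filter (fun Q : Finset (LFLabel F K J) => ∀ e ∈ Q, e.1.val < K - J))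
    (fun Q => heightDensity F γ hJK (histEvent F (θBal F.L γ b₀ p₀) K J Q)) _
    (fun Q' X h => ⟨(hAdm Q' X h).1, fun l hl => ((hAdm Q' X h).2.1 l hl).2, by
      obtain ⟨Fc, hc, hX⟩ := hAdmFc Q' X h
      exact ⟨Fc, hc, hX, by rw [← hX, card_image_blk_biUnion_cell hd hμ']⟩⟩)
    hℓ hsum
    (fun Q hQ => hrat Q (Finset.mem_filter.mp hQ).2)
    (fun Q hQ U _ => ratio_eq_zero_of_not_deep _ Adm (fun Q' X => ζ Q' X U) (fun l : LFLabel F K J => l.1.val < K - J) hdeep Q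
      (fun h => hQ (Finset.mem_filter.mpr ⟨Finset.mem_univ _, h⟩)))
    (fun Q U _ => rfl) hζc hloc hdom hζ0 hsf hζ hσ hΨ hrate

end Summit.QuantumFields.YangMills.Theorems.FluctuationComparisonRegPrIntLLargeFieldGasSocketOfEngine

end
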